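import Summits.QuantumFields.YangMills.Theorems.BalabanUVNodesN09ChartReadAveragingSubmersion
import Summits.QuantumFields.YangMills.Theorems.AlphaInputsT3ACBlockAvgEMLWeightedFibreChart
import Literature.MathematicalPhysics.QuantumFieldTheory.Balaban1983to89.HaarExpChartLocalFacePositivity
import Literature.MathematicalPhysics.QuantumFieldTheory.Balaban1983to89.T3OrbitAverage
import Literature.MeasureTheory.Integral.SubmersionPushforwardDensity
import HarnessLib

/-!
# `AlphaInputsT3ACAvgFunLocalLowerDensity` — LOCAL LOWER DENSITY OF BAŁABAN'S BLOCK AVERAGING ON THE LOOP GUARD, AND «THE WINDOW-RESTRICTED PUSH-FORWARD OF HAAR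
# CHARGES EVERY FAMILY OF DEEP FIBRE POINTS» (cell `ym3-torus`, ★★OWNER g35 RECORD 17cm: (α)-row #23 `fibre57LowOn` residue `{hcharge ⟸ (L1) (L2) (L3) (L4)}`, 19936 evidence
# #57 ∕ px20 g13 LOCATE 9c6dab4c; seat `ym-ust-19936-w8` g16, TWIN-WIDTH helper; `--supports stmt-QuantumFields-19936 --as helper`; generic-`P` file, the T³ record edition is the
# sibling `…AlphaInputsT3ACChargeOfDeepFibrePoint`)

WHAT.  ✓`PinnedStepTrivPins.fibre57LowOnAC_T3_of_le_gamma_of_hcharge` (✓`…AlphaInputsT3ACv3StepLowCharge`, px20 g13) proves the lower step row R3D-02χ at the T³ record modulo,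
among displayed letters, the chart-free CHARGING letter `hcharge`: «a measurable `N ⊆ lo (k+1)` with `dU (O_ε ∩ {χB_k(triv′) ≠ 0} ∩ Ū⁻¹ N) = 0` is `dV`-null» (`Ū = avgFun expMeanLogSU`
Bałaban's block averaging [Balaban1987RG1] (0.4), `dU`∕`dV` the product Haar measures `fieldMeasure` of levels `j`∕`j+1`, `O_ε` a small-loop region).  The LOCATE cut `hcharge` into
(L1) a deep fibre point, (L2) local submersion, (L3) positive local density, (L4) assembly.  THIS FILE proves (L2)+(L3)+(L4) — for every lattice `P` in the standing range
`j + 1 ≤ m + K` and every `SU(N)` — from carriers ALREADY IN THE TREE, the pub-ymgap N09 local route (dag-n09-w2∕w4, dag-n07-w2; credited there):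
* §1 ★★★ `exists_local_lower_density_avgFun` — for an OPEN `𝒩 ∋ U₀` with `U₀` in the STRICT loop `α`-guard (`α ≤ 1∕24`, `α < δ_N`, `157·α < L^{1−d}`) there are an open
  `D ∋ Ū(U₀)` and `c > 0` with `c·dV(S) ≤ dU(𝒩 ∩ Ū⁻¹S)` for all measurable `S ⊆ D`.  Proof: a closed ball `K₀ ∋ U₀` inside `𝒩 ∩ guard` (compatible metric,
  `TopologicalSpace.metrizableSpaceMetric`), a continuous bump `r ≤ 𝟙_{K₀}` with `r(U₀) = 1`; ✓`N09ChartReadAveragingSubmersion.exists_continuous_density_avgFun_of_loopSmall` gives a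
  CONTINUOUS density `g` of `Ū_*(r·dU)`; `g(Ū U₀) > 0` because the chart-read average is a `C¹` SUBMERSION at `0` (✓`fderiv_chartRead_avgFun_range_eq_top` fed to
  ✓`SubmersionPushforward.exists_continuousOn_density_map_of_submersion_pos` and ✓`IsChartRep.density_pos_pi_haar_of_chartRead`); `D := {g > g(ŪU₀)∕2}`.
* §2 ★ `null_of_local_lower_density` — GENERIC measure theory: local lower densities at every point of `L` ⟹ «`N ⊆ L` measurable with `μ₀ (E ∩ A⁻¹ N) = 0` is `μ₁`-null»
  (Mathlib `measure_null_of_locally_null`: second countability ∕ Lindelöf).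
* §3 `isOpen_setOf_chiB_triv_ne_zero` (the support of the small-field factor `χB_k(triv′)` of [Balaban1985UV3] (49) at the trivial new history is the STRICT plaquette window, open) and
  ★★★ `charge_of_deepFibrePoints` — for a loop radius `ε` meeting the three N09 conditions and ANY family `L` of coarse fields each of which is `Ū(U₀)` for some `U₀` with
  `ε`-small loops and `χB_j(triv′)(U₀) ≠ 0`: every measurable `N ⊆ L` with `dU ({loops < ε} ∩ {χB ≠ 0} ∩ Ū⁻¹ N) = 0` is `dV`-null — the `hcharge` SHAPE of ✓p774960 at a generic
  lattice; the T³ record edition (`P := F.P K`, `N = 2`, `ε := ε_P = (360·L³)⁻¹`, loops discharged by the size line) is the sibling file.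

HONEST SCOPE.  [folklore] measure theory + bookkeeping over the pub-ymgap N09 lineage's theorems and Mathlib; def-free; nothing of [Balaban1985UV3] (37)∕(47)∕(57), of row #23, of
the (α) data rows (0∕23), of (O‴χₛ), `HistoryTailL` (19936), EX, LOWB∘ or `YM3TorusSU2` is proved (rung R3 = SU(2) YM₃ on T³, a RECORD rung: NOT d = 4, NOT infinite volume, NOT a
mass gap, NOT Clay; the Yang–Mills mass gap is NOT proved).  L-floor: none (standing range `j + 1 ≤ m + K` only).
References: T. Bałaban, Commun. Math. Phys. **109** (1987) 249–301 [Balaban1987RG1] ((0.4) p.253, (2.10) p.267); **102** (1985) 255–275 [Balaban1985UV3] ((47) p.267, (49) p.268);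
L. C. Evans, R. F. Gariepy, *Measure Theory and Fine Properties of Functions*, CRC 1992 [EvansGariepy1992] (§3.4.3 Thm 2).
-/

set_option autoImplicit false

noncomputable section

open scoped Matrix.Norms.L2Operator Topology ENNReal NNReal
open Filter Set Function MeasureTheory

namespace Summit.QuantumFields.YangMills.Theorems.AvgFunLocalLowerDensity

open Literature.MathematicalPhysics.QuantumFieldTheory.Balaban1983to89
open Literature.MathematicalPhysics.QuantumFieldTheory.Balaban1983to89.HaarExponentialChart
open Literature.MathematicalPhysics.QuantumFieldTheory.Balaban1983to89.HaarExponentialChart.IsChartRep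
open Literature.MathematicalPhysics.QuantumFieldTheory.Balaban1983to89.BlockAveraging (Small Idx avgFun loopHol measurable_avgFun continuous_loopHol)
open Literature.MathematicalPhysics.QuantumFieldTheory.Balaban1983to89.ExpMeanLog (expMeanLogSU deltaSU measurable_expMeanLogSU_E)
open Literature.MathematicalPhysics.QuantumFieldTheory.Balaban1983to89.FieldMeasureExpChartChangeOfVariables
  (isHaarMeasure_haar_specialUnitaryGroup isMulRightInvariant_haar)
open Literature.MathematicalPhysics.QuantumFieldTheory.Balaban1983to89.T3OrbitAverage
open Literature.MathematicalPhysics.QuantumFieldTheory.Balaban1983to89.B12ContinuousTransportInvarianceOn (continuous_dist1_SU)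
open Literature.MeasureTheory.Integral.SubmersionPushforward (exists_continuousOn_density_map_of_submersion_pos)
open Summit.QuantumFields.YangMills.BalabanUVNodes.N09ChartReadAveragingSmooth
open Summit.QuantumFields.YangMills.BalabanUVNodes.N09ChartReadAveragingSubmersion

variable {P : Params} {j : ℕ} {N : ℕ} [NeZero N]

/-- The STRICT loop `α`-guard `{U | ∀ c i, |U(loop c i) − 1| < α}` of the (0.4) averaging is open (finitely many strict inequalities between continuous functions of the
configuration). [cite: Balaban1987RG1, (0.4) p.253] -/
theorem isOpen_setOf_loopHol_lt (α : ℝ) :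
    IsOpen {U : GaugeField P j (Matrix.specialUnitaryGroup (Fin N) ℂ) | ∀ c i, dist1 (loopHol U c i) < α} := by
  have h : {U : GaugeField P j (Matrix.specialUnitaryGroup (Fin N) ℂ) | ∀ c i, dist1 (loopHol U c i) < α} =
      ⋂ c : PBond P (j + 1), ⋂ i : Idx P, {U | dist1 (loopHol U c i) < α} := by
    ext U; simp only [mem_setOf_eq, mem_iInter]
  rw [h]
  exact isOpen_iInter_of_finite fun c => isOpen_iInter_of_finite fun i =>
    isOpen_lt ((continuous_dist1_SU (N := N)).comp ((continuous_apply i).comp (continuous_loopHol c))) continuous_const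

/-- ★★★ **LOCAL LOWER DENSITY OF THE (0.4) BLOCK AVERAGING ON THE LOOP GUARD.**  `G = SU(N)`, standing range `j + 1 ≤ m + K`; `𝒩` an OPEN set of level-`j`
configurations and `U₀ ∈ 𝒩` a configuration in the STRICT loop `α`-guard (`|U₀(loop) − 1| < α` at every (0.4) loop, `α ≤ 1∕24`, `α < δ_N`, `157·α < L^{1−d}`).  THEN
there are an open `D ∋ Ū(U₀)` and `c > 0` with `c · dV(S) ≤ dU(𝒩 ∩ Ū⁻¹ S)` for every measurable `S ⊆ D` (`dU`, `dV` the product Haar measures `fieldMeasure`,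
`Ū = avgFun expMeanLogSU`): the push-forward of `dU↾𝒩` has density BOUNDED BELOW near `Ū(U₀)`.  Proof: a closed ball `K₀ ∋ U₀` inside `𝒩 ∩ guard` (for a
compatible metric) and the continuous bump `r := max 0 (1 − 2·dist(·,U₀)∕δ) ≤ 𝟙_{K₀}`, `r(U₀) = 1`; the pub-ymgap N09 local route gives a CONTINUOUS density `g` of
`Ū_*(r·dU)` (`N09ChartReadAveragingSubmersion.exists_continuous_density_avgFun_of_loopSmall`), POSITIVE at `Ū(U₀)` because the chart-read average is a `C¹` SUBMERSION there
(`fderiv_chartRead_avgFun_range_eq_top` + `SubmersionPushforward.exists_continuousOn_density_map_of_submersion_pos` + `IsChartRep.density_pos_pi_haar_of_chartRead`); take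
`D := {g > g(Ū U₀)∕2}`, `c := g(Ū U₀)∕2`, and `∫_S g dV = (r·dU)(Ū⁻¹S) ≤ dU(K₀ ∩ Ū⁻¹S)`.
[cite: Balaban1987RG1, (0.4) p.253 and (2.10) p.267 (measure-level reading)] [cite: EvansGariepy1992, §3.4.3 Thm 2] -/
theorem exists_local_lower_density_avgFun (hj : j + 1 ≤ P.m + P.K) {α : ℝ} (hα24 : α ≤ 1 / 24) (hαδ : α < deltaSU (Fin N))
    (hαL : 157 * α < ((P.L : ℝ) ^ (P.d - 1))⁻¹)
    {𝒩 : Set (GaugeField P j (Matrix.specialUnitaryGroup (Fin N) ℂ))} (h𝒩 : IsOpen 𝒩)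
    {U₀ : GaugeField P j (Matrix.specialUnitaryGroup (Fin N) ℂ)} (hU₀ : U₀ ∈ 𝒩) (hα : ∀ c i, dist1 (loopHol U₀ c i) < α) :
    ∃ D : Set (GaugeField P (j + 1) (Matrix.specialUnitaryGroup (Fin N) ℂ)), IsOpen D ∧ avgFun (expMeanLogSU (n := Fin N)) U₀ ∈ D ∧
      ∃ c : ℝ≥0∞, 0 < c ∧ ∀ S : Set (GaugeField P (j + 1) (Matrix.specialUnitaryGroup (Fin N) ℂ)), MeasurableSet S → S ⊆ D →
        c * fieldMeasure P (j + 1) (Matrix.specialUnitaryGroup (Fin N) ℂ) S ≤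
          fieldMeasure P j (Matrix.specialUnitaryGroup (Fin N) ℂ) (𝒩 ∩ avgFun (expMeanLogSU (n := Fin N)) ⁻¹' S) := by
  classical
  -- instances: the Lie model of the chart as a Borel space, Haar on `SU(N)`, additive Haar on the chart models
  letI : MeasurableSpace (specialUnitaryLogChart (Fin N)).lie := borel _
  haveI : BorelSpace (specialUnitaryLogChart (Fin N)).lie := ⟨rfl⟩
  haveI := isHaarMeasure_haar_specialUnitaryGroup (N := N)
  haveI : (HaarData.haar : Measure (Matrix.specialUnitaryGroup (Fin N) ℂ)).IsMulRightInvariant := isMulRightInvariant_haar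
  haveI : (Measure.pi fun _ : PBond P j => (Module.finBasis ℝ (specialUnitaryLogChart (Fin N)).lie).addHaar).IsAddHaarMeasure :=
    Measure.pi.isAddHaarMeasure _
  haveI : (Measure.pi fun _ : PBond P (j + 1) => (Module.finBasis ℝ (specialUnitaryLogChart (Fin N)).lie).addHaar).IsAddHaarMeasure :=
    Measure.pi.isAddHaarMeasure _
  -- a compatible metric on the configuration space
  letI : MetricSpace (GaugeField P j (Matrix.specialUnitaryGroup (Fin N) ℂ)) := TopologicalSpace.metrizableSpaceMetric _
  -- the open set `𝒩 ∩ {strict guard}` and a ball around `U₀` inside it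
  have hWo : IsOpen (𝒩 ∩ {U : GaugeField P j (Matrix.specialUnitaryGroup (Fin N) ℂ) | ∀ c i, dist1 (loopHol U c i) < α}) :=
    h𝒩.inter (isOpen_setOf_loopHol_lt (P := P) (j := j) (N := N) α)
  obtain ⟨δ, hδ, hball⟩ := Metric.isOpen_iff.1 hWo U₀ ⟨hU₀, hα⟩
  -- the closed ball `K₀` of radius `δ/2` and the bump `r`
  set K₀ : Set (GaugeField P j (Matrix.specialUnitaryGroup (Fin N) ℂ)) := Metric.closedBall U₀ (δ / 2) with hK₀
  have hK₀W : K₀ ⊆ 𝒩 ∩ {U | ∀ c i, dist1 (loopHol U c i) < α} := fun U hU =>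
    hball (Metric.mem_ball.2 (lt_of_le_of_lt (Metric.mem_closedBall.1 hU) (half_lt_self hδ)))
  set r : GaugeField P j (Matrix.specialUnitaryGroup (Fin N) ℂ) → ℝ := fun U => max 0 (1 - 2 * dist U U₀ / δ) with hr
  have hrc : Continuous r :=
    continuous_const.max (continuous_const.sub ((continuous_const.mul (continuous_id.dist continuous_const)).div_const _))
  have hrm : Measurable r := hrc.measurable
  have hr0 : ∀ U, 0 ≤ r U := fun U => le_max_left _ _
  have hr1 : ∀ U, r U ≤ 1 := fun U => max_le zero_le_one (by
    have : 0 ≤ 2 * dist U U₀ / δ := div_nonneg (mul_nonneg zero_le_two dist_nonneg) hδ.le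
    linarith)
  have hrU₀ : r U₀ = 1 := by simp only [hr, dist_self, mul_zero, zero_div, sub_zero]; exact max_eq_right zero_le_one
  have hrK : ∀ U, U ∉ K₀ → r U = 0 := fun U hU => by
    have hd : δ / 2 < dist U U₀ := lt_of_not_ge fun h => hU (Metric.mem_closedBall.2 h)
    have hneg : 1 - 2 * dist U U₀ / δ < 0 := by
      rw [sub_neg, lt_div_iff₀ hδ]; linarith
    simp only [hr]; exact max_eq_left hneg.le
  -- the continuous density `g` of `Ū_*(r·dU)` (pub-ymgap N09 local route)
  obtain ⟨g, hgc, -, hgS, -⟩ := exists_continuous_density_avgFun_of_loopSmall (P := P) (j := j) (N := N) hj hα24 hαδ hαL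
    (K := K₀) Metric.isClosed_closedBall (fun U hU c i => le_of_lt ((hK₀W hU).2 c i)) r hrm hr0 (fun U _ => hrc.continuousAt)
    ⟨1, hr1⟩ hrK
  -- positivity of `g` at `Ū(U₀)`: the chart-read average is a `C¹` submersion at `0`
  have hsmall : ∀ c, Small (expMeanLogSU (n := Fin N)) U₀ c := fun c i => lt_trans (hα c i) hαδ
  have hflat := exists_continuousOn_density_map_of_submersion_pos
    (Measure.pi fun _ : PBond P j => (Module.finBasis ℝ (specialUnitaryLogChart (Fin N)).lie).addHaar)
    (Measure.pi fun _ : PBond P (j + 1) => (Module.finBasis ℝ (specialUnitaryLogChart (Fin N)).lie).addHaar)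
    (measurable_chartRead_avgFun (P := P) (j := j) U₀)
    ((contDiffAt_chartRead_avgFun (P := P) (j := j) U₀ hsmall).of_le le_top)
    (fderiv_chartRead_avgFun_range_eq_top (P := P) (j := j) hj (fun c i => (hα c i).le) hα24 hαδ hαL)
  have hpos : 0 < g (avgFun (expMeanLogSU (n := Fin N)) U₀) :=
    (isChartRep_specialUnitaryGroup (n := Fin N)).density_pos_pi_haar_of_chartRead (lie_adStable_specialUnitaryGroup (n := Fin N))
      ((Module.finBasis ℝ (specialUnitaryLogChart (Fin N)).lie).addHaar) (HaarData.haar : Measure (Matrix.specialUnitaryGroup (Fin N) ℂ))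
      (measurable_avgFun _ measurable_expMeanLogSU_E) U₀ (continuousAt_avgFun_of_small (P := P) (j := j) U₀ hsmall) hflat
      hrm hr0 hrc.continuousAt (by rw [hrU₀]; exact one_pos) isOpen_univ (mem_univ _) hgc.continuousAt
      (fun S' hS' _ => (hgS S' hS').le)
  -- the window and the constant
  set g₀ : ℝ := g (avgFun (expMeanLogSU (n := Fin N)) U₀) with hg₀
  refine ⟨{V | g₀ / 2 < g V}, isOpen_lt continuous_const hgc, by show g₀ / 2 < g₀; linarith, ENNReal.ofReal (g₀ / 2),
    ENNReal.ofReal_pos.2 (half_pos hpos), fun S hS hSD => ?_⟩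
  have hpre : MeasurableSet ((avgFun (expMeanLogSU (n := Fin N)) : GaugeField P j (Matrix.specialUnitaryGroup (Fin N) ℂ) →
      GaugeField P (j + 1) (Matrix.specialUnitaryGroup (Fin N) ℂ)) ⁻¹' S) := measurable_avgFun _ measurable_expMeanLogSU_E hS
  have hK₀m : MeasurableSet K₀ := Metric.isClosed_closedBall.measurableSet
  have hrle : ∀ U, ENNReal.ofReal (r U) ≤ K₀.indicator (1 : GaugeField P j (Matrix.specialUnitaryGroup (Fin N) ℂ) → ℝ≥0∞) U := fun U => by
    by_cases hU : U ∈ K₀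
    · rw [indicator_of_mem hU, Pi.one_apply]; exact ENNReal.ofReal_le_one.2 (hr1 U)
    · rw [indicator_of_notMem hU, hrK U hU, ENNReal.ofReal_zero]
  -- the set identity of `g`, read on `fieldMeasure` (`fieldMeasure = Measure.pi _` is `rfl`)
  have hgS' : ((fieldMeasure P j (Matrix.specialUnitaryGroup (Fin N) ℂ)).withDensity fun U => ENNReal.ofReal (r U))
        ((avgFun (expMeanLogSU (n := Fin N))) ⁻¹' S) =
      ∫⁻ V in S, ENNReal.ofReal (g V) ∂(fieldMeasure P (j + 1) (Matrix.specialUnitaryGroup (Fin N) ℂ)) := hgS S hS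
  calc ENNReal.ofReal (g₀ / 2) * fieldMeasure P (j + 1) (Matrix.specialUnitaryGroup (Fin N) ℂ) S
      = ∫⁻ _ in S, ENNReal.ofReal (g₀ / 2) ∂(fieldMeasure P (j + 1) (Matrix.specialUnitaryGroup (Fin N) ℂ)) := (setLIntegral_const _ _).symm
    _ ≤ ∫⁻ V in S, ENNReal.ofReal (g V) ∂(fieldMeasure P (j + 1) (Matrix.specialUnitaryGroup (Fin N) ℂ)) :=
        setLIntegral_mono hgc.measurable.ennreal_ofReal fun V hV => ENNReal.ofReal_le_ofReal (le_of_lt (hSD hV))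
    _ = ((fieldMeasure P j (Matrix.specialUnitaryGroup (Fin N) ℂ)).withDensity fun U => ENNReal.ofReal (r U))
          ((avgFun (expMeanLogSU (n := Fin N))) ⁻¹' S) := hgS'.symm
    _ = ∫⁻ U in (avgFun (expMeanLogSU (n := Fin N))) ⁻¹' S, ENNReal.ofReal (r U) ∂(fieldMeasure P j (Matrix.specialUnitaryGroup (Fin N) ℂ)) :=
        withDensity_apply _ hpre
    _ ≤ ∫⁻ U in (avgFun (expMeanLogSU (n := Fin N))) ⁻¹' S, K₀.indicator (1 : GaugeField P j (Matrix.specialUnitaryGroup (Fin N) ℂ) → ℝ≥0∞) U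
          ∂(fieldMeasure P j (Matrix.specialUnitaryGroup (Fin N) ℂ)) := lintegral_mono fun U => hrle U
    _ = fieldMeasure P j (Matrix.specialUnitaryGroup (Fin N) ℂ) (K₀ ∩ (avgFun (expMeanLogSU (n := Fin N))) ⁻¹' S) :=
        (lintegral_indicator_one hK₀m).trans (Measure.restrict_apply hK₀m)
    _ ≤ fieldMeasure P j (Matrix.specialUnitaryGroup (Fin N) ℂ) (𝒩 ∩ (avgFun (expMeanLogSU (n := Fin N))) ⁻¹' S) :=
        measure_mono (inter_subset_inter_left _ (hK₀W.trans inter_subset_left))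

/-! ## §2 Local lower densities ⟹ the restricted push-forward charges the family (generic measure theory) -/

/-- ★ **LOCAL LOWER DENSITIES CHARGE.**  `A : X → Y` any map, `E ⊆ X`, `L ⊆ Y` with `Y` second countable.  IF every `V ∈ L` has an open `D ∋ V` and `c > 0` with
`c·μ₁(S) ≤ μ₀(E ∩ A⁻¹S)` for all measurable `S ⊆ D`, THEN every measurable `N ⊆ L` with `μ₀ (E ∩ A⁻¹ N) = 0` is `μ₁`-null — `N` is locally `μ₁`-null
(`μ₁ (N ∩ D) ≤ c⁻¹·μ₀(E ∩ A⁻¹N) = 0`) and Mathlib's `measure_null_of_locally_null` (Lindelöf) globalises. [folklore] -/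
theorem null_of_local_lower_density {X Y : Type*} [MeasurableSpace X] [MeasurableSpace Y] [TopologicalSpace Y] [SecondCountableTopology Y]
    [OpensMeasurableSpace Y] (μ₀ : Measure X) (μ₁ : Measure Y) (A : X → Y) (E : Set X) {L : Set Y}
    (hloc : ∀ V ∈ L, ∃ D : Set Y, IsOpen D ∧ V ∈ D ∧ ∃ c : ℝ≥0∞, 0 < c ∧
      ∀ S : Set Y, MeasurableSet S → S ⊆ D → c * μ₁ S ≤ μ₀ (E ∩ A ⁻¹' S))
    (N : Set Y) (hN : MeasurableSet N) (hNL : N ⊆ L) (h0 : μ₀ (E ∩ A ⁻¹' N) = 0) : μ₁ N = 0 := by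
  refine measure_null_of_locally_null N fun V hV => ?_
  obtain ⟨D, hDo, hVD, c, hc, hD⟩ := hloc V (hNL hV)
  refine ⟨N ∩ D, inter_mem_nhdsWithin N (hDo.mem_nhds hVD), ?_⟩
  have h := hD (N ∩ D) (hN.inter hDo.measurableSet) inter_subset_right
  have h0' : μ₀ (E ∩ A ⁻¹' (N ∩ D)) = 0 :=
    measure_mono_null (inter_subset_inter_right _ (preimage_mono inter_subset_left)) h0
  rw [h0', nonpos_iff_eq_zero, mul_eq_zero] at h
  exact h.resolve_left hc.ne'


/-! ## §3 The window `{χB_j(triv′) ≠ 0}` is open; the push-forward restricted to `{loops < ε} ∩ {χB ≠ 0}` charges every family of deep fibre points -/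

section Charge

open Summit.QuantumFields.Balaban3D.Carriers (Hist)
open Summit.QuantumFields.Balaban3D.Proofs.Bound55Masses (chiB)
open Summit.QuantumFields.YangMills.Theorems.BlockAvgEMLWeightedFibreChart (plaqSmall_of_chiB_triv_ne_zero)
open Literature.MathematicalPhysics.QuantumFieldTheory.Balaban1983to89.B12ContinuousTransportInvarianceOn (continuous_plaqHol_SU)

/-- At the trivial new history the support `{χB_j(triv′) ≠ 0}` of the small-field factor of (49) is the STRICT plaquette window `{U | ∀ p, |U(∂p) − 1| < ε(j)}` (`P_j = ∅`,
`Ω_{j+1}(triv′) = T`), hence OPEN (`SU(N)`: plaquette variables and `|· − 1|` are continuous). [cite: Balaban1985UV3, (7) p.257 + (49) p.268] -/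
theorem isOpen_setOf_chiB_triv_ne_zero (M₁ : ℕ) (Rcol : ℕ → ℕ) (εS : ℕ → ℝ) :
    IsOpen {U : GaugeField P j (Matrix.specialUnitaryGroup (Fin N) ℂ) | chiB M₁ Rcol εS j (Hist.triv P (j + 1)) U ≠ 0} := by
  classical
  have h : {U : GaugeField P j (Matrix.specialUnitaryGroup (Fin N) ℂ) | chiB M₁ Rcol εS j (Hist.triv P (j + 1)) U ≠ 0} =
      ⋂ p : Plaq P j, {U | dist1 (GaugeField.plaqHol U p) < εS j} := by
    ext U
    simp only [mem_setOf_eq, mem_iInter]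
    refine ⟨fun hU p => plaqSmall_of_chiB_triv_ne_zero M₁ Rcol εS j U hU p, fun hU => ?_⟩
    unfold chiB
    rw [if_pos (fun p _ _ => hU p)]
    exact one_ne_zero
  rw [h]
  exact isOpen_iInter_of_finite fun p => isOpen_lt ((continuous_dist1_SU (N := N)).comp (continuous_plaqHol_SU p)) continuous_const

/-- ★★★ **THE WINDOW-RESTRICTED PUSH-FORWARD OF HAAR CHARGES EVERY FAMILY OF DEEP FIBRE POINTS** (the `hcharge` SHAPE of ✓`PinnedStepTrivPins.hpos_ae_of_hcharge` at a generic
lattice).  `G = SU(N)`, standing range `j + 1 ≤ m + K`, a loop radius `ε` with the three N09 guard conditions (`ε ≤ 1∕24`, `ε < δ_N`, `157·ε < L^{1−d}`), any small-field data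
`M₁ Rcol εS`, and a family `L` of level-`(j+1)` configurations each of which is the block average `Ū(U₀)` of SOME `U₀` with `ε`-small (0.4) loops and `χB_j(triv′)(U₀) ≠ 0`
(`hdeep`).  THEN every measurable `N ⊆ L` with `dU ({loops < ε} ∩ {χB_j(triv′) ≠ 0} ∩ Ū⁻¹ N) = 0` is `dV`-null.  Proof: the set `{loops < ε} ∩ {χB ≠ 0}` is open
(`isOpen_setOf_loopHol_lt`, `isOpen_setOf_chiB_triv_ne_zero`) and contains every `U₀`; §1 gives a local lower density of the restricted push-forward near each `V ∈ L`; §2.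
[cite: Balaban1985UV3, (47) p.267 + (49) p.268] [cite: Balaban1987RG1, (0.4) p.253 and (2.10) p.267] -/
theorem charge_of_deepFibrePoints (hj : j + 1 ≤ P.m + P.K) {ε : ℝ} (hε24 : ε ≤ 1 / 24) (hεδ : ε < deltaSU (Fin N))
    (hεL : 157 * ε < ((P.L : ℝ) ^ (P.d - 1))⁻¹) (M₁ : ℕ) (Rcol : ℕ → ℕ) (εS : ℕ → ℝ)
    {L : Set (GaugeField P (j + 1) (Matrix.specialUnitaryGroup (Fin N) ℂ))}
    (hdeep : ∀ V ∈ L, ∃ U₀ : GaugeField P j (Matrix.specialUnitaryGroup (Fin N) ℂ), avgFun (expMeanLogSU (n := Fin N)) U₀ = V ∧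
      (∀ c i, dist1 (loopHol U₀ c i) < ε) ∧ chiB M₁ Rcol εS j (Hist.triv P (j + 1)) U₀ ≠ 0)
    (Nset : Set (GaugeField P (j + 1) (Matrix.specialUnitaryGroup (Fin N) ℂ))) (hN : MeasurableSet Nset) (hNL : Nset ⊆ L)
    (h0 : fieldMeasure P j (Matrix.specialUnitaryGroup (Fin N) ℂ)
      ({U : GaugeField P j (Matrix.specialUnitaryGroup (Fin N) ℂ) | ∀ c i, dist1 (loopHol U c i) < ε} ∩
        {U | chiB M₁ Rcol εS j (Hist.triv P (j + 1)) U ≠ 0} ∩ (avgFun (expMeanLogSU (n := Fin N))) ⁻¹' Nset) = 0) :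
    fieldMeasure P (j + 1) (Matrix.specialUnitaryGroup (Fin N) ℂ) Nset = 0 := by
  have h𝒩 := (isOpen_setOf_loopHol_lt (P := P) (j := j) (N := N) ε).inter (isOpen_setOf_chiB_triv_ne_zero (P := P) (j := j) (N := N) M₁ Rcol εS)
  refine null_of_local_lower_density (fieldMeasure P j (Matrix.specialUnitaryGroup (Fin N) ℂ))
    (fieldMeasure P (j + 1) (Matrix.specialUnitaryGroup (Fin N) ℂ)) (avgFun (expMeanLogSU (n := Fin N))) _ (L := L)
    (fun V hV => ?_) Nset hN hNL h0
  obtain ⟨U₀, hU₀V, hU₀ε, hχ⟩ := hdeep V hV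
  obtain ⟨D, hDo, hU₀D, c, hc, hD⟩ :=
    exists_local_lower_density_avgFun (P := P) (j := j) (N := N) hj hε24 hεδ hεL h𝒩 ⟨hU₀ε, hχ⟩ hU₀ε
  exact ⟨D, hDo, hU₀V ▸ hU₀D, c, hc, hD⟩

end Charge

end Summit.QuantumFields.YangMills.Theorems.AvgFunLocalLowerDensity

end
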